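import Mathlib.Data.Real.Basic
import Mathlib.Tactic.Linarith
import Mathlib.Tactic.Ring

/-!
# Sign criterion for convex directions of the port potentials `Φ₄`, `Φ₃` (route PercNearOneGluingNoHeavy, (MAXDIR) line)

Along the weight `r` of a port pair `e ∋ c` the three quantities `Q' = P(F ∩ c↮T)`, `I'_A = P(F ∩ c↮{s,a})`,
`I'_b = P(F ∩ c↮b)` (`F = {s↔a} ∩ {s↮b}`) are affine, and with the logarithmic slopes
`X = -∂Q'/Q'`, `A = -∂I'_A/I'_A`, `B = -∂I'_b/I'_b`, `S = A + B` one has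
`Φ₄''/Φ₄ = 4(3X - S)(X - S) + 2(A² + B²)` for `Φ₄ = Q'⁴/(I'_A I'_b)²` and
`Φ₃''/Φ₃ = ¾(A - B)² + 3(X - S)(2X - S)` for the sextic version.
The lemmas below are the algebraic heart of the ONE-SIDED NEIGHBOUR LEMMA (lead gen 126, note
`R4-ONE-SIDED-NEIGHBOUR-LEMMA.md`): for port pairs `X ≥ 0` and `A ≥ 0` always (no gains), and whenever
`B ≤ 0` (e.g. `w` cut from `b` by `{s,a,c}`: no loss for `I'_b`) or `A ≤ 0` (e.g. `w` cut from `{s,a}` by `{b,c}`: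
`A = 0`) the direction `e` is convex for both potentials — because the quadratic form in the remaining
variable has positive leading coefficient and discriminant `-16(5B² - 8XB + 2X²) ≤ 0`
(resp. `-9(4B² - 6XB + X²) ≤ 0`) as soon as `X·B ≤ 0`.
-/

namespace Summit.CriticalPhenomena.PercolationContinuityZ3.Theorems.IncStar

/-- `Φ₄` sign criterion, `b`-side: if `X ≥ 0` and `B ≤ 0` then
`4(3X - (A+B))(X - (A+B)) + 2(A² + B²) ≥ 0` for every `A`.
Certificate: the expression equals `6(A + (2B - 4X)/3)² + (2/3)(2X² - 8XB + 5B²)`. -/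
theorem maxdir_phi4_sign_criterion_b (X A B : ℝ) (hX : 0 ≤ X) (hB : B ≤ 0) :
    0 ≤ 4 * (3 * X - (A + B)) * (X - (A + B)) + 2 * (A ^ 2 + B ^ 2) := by
  have hXB : 0 ≤ -(X * B) := by nlinarith
  nlinarith [sq_nonneg (3 * A + 2 * B - 4 * X), sq_nonneg X, sq_nonneg B]

/-- `Φ₄` sign criterion, `S`-side: if `X ≥ 0` and `A ≤ 0` then
`4(3X - (A+B))(X - (A+B)) + 2(A² + B²) ≥ 0` for every `B` (the form is symmetric in `A`, `B`). -/
theorem maxdir_phi4_sign_criterion_a (X A B : ℝ) (hX : 0 ≤ X) (hA : A ≤ 0) :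
    0 ≤ 4 * (3 * X - (A + B)) * (X - (A + B)) + 2 * (A ^ 2 + B ^ 2) := by
  have h := maxdir_phi4_sign_criterion_b X B A hX hA
  nlinarith [h]

/-- `Φ₃` sign criterion, `b`-side: if `X ≥ 0` and `B ≤ 0` then
`¾(A - B)² + 3(X - (A+B))(2X - (A+B)) ≥ 0` for every `A`
(quadratic in `A` with leading coefficient `15/4` and discriminant `-9(4B² - 6XB + X²) ≤ 0`). -/
theorem maxdir_phi3_sign_criterion_b (X A B : ℝ) (hX : 0 ≤ X) (hB : B ≤ 0) :
    0 ≤ 3 / 4 * (A - B) ^ 2 + 3 * (X - (A + B)) * (2 * X - (A + B)) := by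
  have hXB : 0 ≤ -(X * B) := by nlinarith
  nlinarith [sq_nonneg (15 * A + 9 * B - 18 * X), sq_nonneg X, sq_nonneg B]

/-- `Φ₃` sign criterion, `S`-side: if `X ≥ 0` and `A ≤ 0` then
`¾(A - B)² + 3(X - (A+B))(2X - (A+B)) ≥ 0` for every `B`. -/
theorem maxdir_phi3_sign_criterion_a (X A B : ℝ) (hX : 0 ≤ X) (hA : A ≤ 0) :
    0 ≤ 3 / 4 * (A - B) ^ 2 + 3 * (X - (A + B)) * (2 * X - (A + B)) := by
  have h := maxdir_phi3_sign_criterion_b X B A hX hA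
  nlinarith [h]

/-- The `S`-cut normal form: if `A = 0` and `B = X` (the identities of the `S`-cut case) then
`Φ₄''/Φ₄ = 2X²` and `Φ₃''/Φ₃ = ¾X²`, i.e. normalised margins `1` and `3/8`. -/
theorem maxdir_scut_normal_form (X : ℝ) :
    4 * (3 * X - (0 + X)) * (X - (0 + X)) + 2 * (0 ^ 2 + X ^ 2) = 2 * X ^ 2 ∧
      3 / 4 * (0 - X) ^ 2 + 3 * (X - (0 + X)) * (2 * X - (0 + X)) = 3 / 4 * X ^ 2 := by
  constructor <;> ring

/-- Ellipse normal form of `Φ₄''/Φ₄`: with `S = A + B`,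
`4(3X - S)(X - S) + 2(A² + B²) = 5(S - 8X/5)² + (A - B)² - (4/5)X²`; hence (for `X > 0`, `σ = S/X`,
`δ = (A - B)/X`) the direction is concave iff `5(σ - 8/5)² + δ² < 4/5` — an ellipse centred at
`σ = 8/5`, `δ = 0` (`σ ∈ (6/5, 2)`, `|δ| < 2/√5`). -/
theorem maxdir_phi4_normal_form (X A B : ℝ) :
    4 * (3 * X - (A + B)) * (X - (A + B)) + 2 * (A ^ 2 + B ^ 2) =
      5 * (A + B - 8 / 5 * X) ^ 2 + (A - B) ^ 2 - 4 / 5 * X ^ 2 := by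
  ring

/-- Ellipse normal form of `Φ₃''/Φ₃`:
`¾(A - B)² + 3(X - S)(2X - S) = 3(S - 3X/2)² + ¾(A - B)² - ¾X²`; concave iff
`4(σ - 3/2)² + δ² < 1` (`σ ∈ (1, 2)`, `|δ| < 1`). -/
theorem maxdir_phi3_normal_form (X A B : ℝ) :
    3 / 4 * (A - B) ^ 2 + 3 * (X - (A + B)) * (2 * X - (A + B)) =
      3 * (A + B - 3 / 2 * X) ^ 2 + 3 / 4 * (A - B) ^ 2 - 3 / 4 * X ^ 2 := by
  ring

/-- Ratio form of the sign criterion for `Φ₄`: the quadratic in `A` has discriminant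
`-16(5B² - 8XB + 2X²)`, so `0 ≤ 5B² - 8XB + 2X²` — i.e. for `X > 0`, `B/X` outside the root interval
`((4 - √6)/5, (4 + √6)/5) ≈ (0.310, 1.290)`, in particular whenever `B ≤ 0 ≤ X` — makes the direction
convex for every `A` (and symmetrically with `A`, `B` exchanged). -/
theorem maxdir_phi4_ratio_criterion (X A B : ℝ) (h : 0 ≤ 5 * B ^ 2 - 8 * X * B + 2 * X ^ 2) :
    0 ≤ 4 * (3 * X - (A + B)) * (X - (A + B)) + 2 * (A ^ 2 + B ^ 2) := by
  nlinarith [sq_nonneg (3 * A + 2 * B - 4 * X), h]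

/-- Balanced-hub factorisation (the mechanism of the census W99 counterexamples to the pointwise
(MAXDIR) conjecture): on a port pair with `A = X` ("balanced two-sided hub", `α = 1`) one has
`Φ₄''/Φ₄ = 2(3B - X)(B - X)`, so the pair is `Φ₄`-concave exactly when `X/3 < B < X`
(`β = B/X ∈ (1/3, 1)`); the counterexamples put every port pair of `c` there (`β ≈ 0.314…0.335`). -/
theorem maxdir_phi4_balanced_hub (X A B : ℝ) (h : A = X) :
    4 * (3 * X - (A + B)) * (X - (A + B)) + 2 * (A ^ 2 + B ^ 2) = 2 * (3 * B - X) * (B - X) := by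
  subst h; ring

/-- Balanced-hub factorisation for `Φ₃`: on a port pair with `A = X`,
`Φ₃''/Φ₃ = ¾(X - B)(X - 5B)`, concave exactly when `X/5 < B < X`. -/
theorem maxdir_phi3_balanced_hub (X A B : ℝ) (h : A = X) :
    3 / 4 * (A - B) ^ 2 + 3 * (X - (A + B)) * (2 * X - (A + B)) = 3 / 4 * (X - B) * (X - 5 * B) := by
  subst h; ring

end Summit.CriticalPhenomena.PercolationContinuityZ3.Theorems.IncStar
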